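import Literature.MathematicalPhysics.QuantumLattice.HubbardPairDensityCouplingFloor
import Literature.MathematicalPhysics.QuantumLattice.FreeFermiGasPairingCostLog
import HarnessLib

/-!
# Ground-state `d`-wave pair density of the Hubbard torus: the `O(U log(1/U))` ceiling in CLOSED form

Family `hubbard` / topic `MathematicalPhysics/QuantumLattice`; proof-only companion of the
coupling-floor files (`HubbardPairDensityCouplingFloor{,Sharp,Optimal,Log}.lean`; only the first is
imported, together with `FreeFermiGasPairingCostLog.lean`, and the two-line energy balance of
`…FloorLog.lean` is re-derived). The logarithmic (Bardeen–Cooper–Schrieffer-rate) bound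
`pairDensity_le_mul_coupling_mul_log` of `…FloorLog.lean` reads `c ≤ (4096/√d₀)·U·log(4 + 32/√c)` —
implicit in the pair density `c`. Here it is inverted:

* `le_mul_log_of_le_mul_log_sqrt_self` — `0 < c ≤ A·U·log(4 + 32/√c) ⇒ c ≤ A·U·log(4 + 32/√(A·U))`
  (either `c ≤ A·U`, or the logarithm is antitone in `c`); primed form with `√U` for `A ≥ 1`;
* `gapParam_le_two_of_card_hyps` — the level-count hypotheses `#{ε_L < -4 + d₀} < n ≤ #{ε_L ≤ -d₀}`
  force `d₀ ≤ 2`, hence `4096/√d₀ ≥ 1`;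
* `pairDensity_le_mul_coupling_mul_log_coupling` — a normalised ground state `ψ` of
  `hubbardTorus 2 L 1 U` (`U > 0`) in a sector `(2n, S^z = 0)` with `n ≤ #{ε_L ≤ -d₀}`,
  `#{ε_L < -4 + d₀} < n`, `L ≥ 3`, `c·L² ≥ 12800`, `√d₀·L ≥ 40` and `Re ⟨ψ, Δ_d†Δ_d ψ⟩ ≥ c·L⁴`
  (`c > 0`) has **`c ≤ (4096/√d₀) · U · log(4 + 32/√U)`** — no `c` on the right: the ground-state
  `d`-wave pair density of the weakly repulsive Hubbard torus at a regular filling is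
  `O_{d₀}(U log(1/U))` as `U → 0⁺`, in closed form (the hypothesis `n ≤ L²` of the floor files is
  now read off `n ≤ #{ε_L ≤ -d₀}`);
* `re_expect_pairField_dWave_lt_of_groundStateInSector_log_coupling` — the a-priori form.

The doped/even-side specialisation and the statement in the format of the summit `hubbard.S01`
(`liminf` of the LRO sequence) are in `HubbardDWaveLROCeiling.lean`.

Sources: Bardeen–Cooper–Schrieffer, Phys. Rev. 108 (1957) 1175, §II–III; C. N. Yang, Rev. Mod.
Phys. 34 (1962) 694, §4; H. Tasaki, Physics and Mathematics of Quantum Many-Body Systems (2020)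
§2.2 (variational principle). Folklore finite-dimensional statements; no named facts, no definitions.
Tree search: `pairDensity_le_mul_coupling_mul_log`, `freeDWavePairing_costs_energy_log_explicit`,
`re_expect_hubbardTorus_zero_le_of_groundStateInSector`, `card_torusSite`; Mathlib: `Real.log_le_log`,
`Real.exp_one_lt_d9`, `Real.sqrt_le_sqrt`, `div_le_div_of_nonneg_left`.
-/

noncomputable section

namespace Literature.MathematicalPhysics.QuantumLattice

open Matrix Finset Filter Literature.Probability.LatticeModels
open scoped ComplexOrder ComplexConjugate

/-! ### Elementary inversion of the implicit logarithmic bound -/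

/-- **Inversion.** If `0 < c ≤ A·U·log(4 + 32/√c)` then `c ≤ A·U·log(4 + 32/√(A·U))`: either
`c ≤ A·U` (and `log(4 + ·) ≥ log 4 ≥ 1`), or `A·U < c` and the logarithm is antitone in `c`. (The
hypothesis forces `A·U > 0`.) [folklore] -/
theorem le_mul_log_of_le_mul_log_sqrt_self {c A U : ℝ} (hc : 0 < c)
    (h : c ≤ A * U * Real.log (4 + 32 / Real.sqrt c)) :
    c ≤ A * U * Real.log (4 + 32 / Real.sqrt (A * U)) := by
  have hlogc : 0 < Real.log (4 + 32 / Real.sqrt c) := by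
    have : 0 < 32 / Real.sqrt c := by
      have := Real.sqrt_pos.2 hc
      positivity
    exact Real.log_pos (by linarith)
  have hAU : 0 < A * U := by
    by_contra hAU
    push Not at hAU
    have : A * U * Real.log (4 + 32 / Real.sqrt c) ≤ 0 :=
      mul_nonpos_of_nonpos_of_nonneg hAU hlogc.le
    linarith
  rcases le_or_gt c (A * U) with hle | hlt
  · have hlog4 : (1 : ℝ) ≤ Real.log 4 := by
      rw [← Real.log_exp 1]
      refine Real.log_le_log (Real.exp_pos 1) ?_
      have := Real.exp_one_lt_d9
      linarith
    have hlog : (1 : ℝ) ≤ Real.log (4 + 32 / Real.sqrt (A * U)) := by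
      refine hlog4.trans (Real.log_le_log (by norm_num) ?_)
      have : 0 ≤ 32 / Real.sqrt (A * U) := by positivity
      linarith
    calc c ≤ A * U := hle
      _ = A * U * 1 := (mul_one _).symm
      _ ≤ A * U * Real.log (4 + 32 / Real.sqrt (A * U)) :=
          mul_le_mul_of_nonneg_left hlog hAU.le
  · have hsq : Real.sqrt (A * U) ≤ Real.sqrt c := Real.sqrt_le_sqrt hlt.le
    have hpos : 0 < Real.sqrt (A * U) := Real.sqrt_pos.2 hAU
    have h32 : 32 / Real.sqrt c ≤ 32 / Real.sqrt (A * U) :=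
      div_le_div_of_nonneg_left (by norm_num) hpos hsq
    have hlog : Real.log (4 + 32 / Real.sqrt c) ≤ Real.log (4 + 32 / Real.sqrt (A * U)) :=
      Real.log_le_log (by positivity) (by linarith)
    exact h.trans (mul_le_mul_of_nonneg_left hlog hAU.le)

/-- **Inversion, cruder argument.** For `A ≥ 1`, `U > 0`: `0 < c ≤ A·U·log(4 + 32/√c)` gives
`c ≤ A·U·log(4 + 32/√U)` (`√U ≤ √(A·U)`). [folklore] -/
theorem le_mul_log_of_le_mul_log_sqrt_self' {c A U : ℝ} (hc : 0 < c) (hA : 1 ≤ A) (hU : 0 < U)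
    (h : c ≤ A * U * Real.log (4 + 32 / Real.sqrt c)) :
    c ≤ A * U * Real.log (4 + 32 / Real.sqrt U) := by
  have h1 := le_mul_log_of_le_mul_log_sqrt_self hc h
  have hAU : 0 < A * U := by positivity
  have hsq : Real.sqrt U ≤ Real.sqrt (A * U) := Real.sqrt_le_sqrt (by nlinarith)
  have hposU : 0 < Real.sqrt U := Real.sqrt_pos.2 hU
  have h32 : 32 / Real.sqrt (A * U) ≤ 32 / Real.sqrt U :=
    div_le_div_of_nonneg_left (by norm_num) hposU hsq
  have hlog : Real.log (4 + 32 / Real.sqrt (A * U)) ≤ Real.log (4 + 32 / Real.sqrt U) :=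
    Real.log_le_log (by positivity) (by linarith)
  exact h1.trans (mul_le_mul_of_nonneg_left hlog hAU.le)

/-- **The ceiling is positive**: `0 < A·U·log(4 + 32/√U)` for `A, U > 0`. [folklore] -/
theorem mul_mul_log_four_add_pos {A U : ℝ} (hA : 0 < A) (hU : 0 < U) :
    0 < A * U * Real.log (4 + 32 / Real.sqrt U) := by
  have : 0 < Real.log (4 + 32 / Real.sqrt U) := by
    have : 0 ≤ 32 / Real.sqrt U := by positivity
    exact Real.log_pos (by linarith)
  positivity

variable {L : ℕ} [NeZero L]

/-- The level-count hypotheses of the logarithmic floor force `d₀ ≤ 2`: if `d₀ > 2` then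
`-d₀ < -4 + d₀`, so `{ε_L ≤ -d₀} ⊆ {ε_L < -4 + d₀}`, contradicting
`#{ε_L < -4 + d₀} < n ≤ #{ε_L ≤ -d₀}`. [folklore] -/
theorem gapParam_le_two_of_card_hyps {d₀ : ℝ} {n : ℕ}
    (hC1 : n ≤ (Finset.univ.filter fun k : TorusSite 2 L => torusBand L k ≤ -d₀).card)
    (hC2 : (Finset.univ.filter fun k : TorusSite 2 L => torusBand L k < (-4 : ℝ) + d₀).card < n) :
    d₀ ≤ 2 := by
  by_contra hd
  push Not at hd
  have hsub : (Finset.univ.filter fun k : TorusSite 2 L => torusBand L k ≤ -d₀) ⊆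
      (Finset.univ.filter fun k : TorusSite 2 L => torusBand L k < (-4 : ℝ) + d₀) := by
    intro k hk
    simp only [Finset.mem_filter, Finset.mem_univ, true_and] at hk ⊢
    linarith
  have := Finset.card_le_card hsub
  omega

/-! ### Closed form at a regular filling -/

/-- **Explicit form: the ground-state `d`-wave pair density at a regular filling is at most
`(4096/√d₀)·U·log(4 + 32/√U)`.** Under the hypotheses of `pairDensity_le_mul_coupling_mul_log`
(minus `n ≤ L²`, which follows from `n ≤ #{ε_L ≤ -d₀}`) and `U > 0`, the implicit bound
`c ≤ (4096/√d₀)·U·log(4 + 32/√c)` inverts to `c ≤ (4096/√d₀)·U·log(4 + 32/√U)` (`4096/√d₀ ≥ 1`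
because the level counts force `d₀ ≤ 2`).
Bardeen–Cooper–Schrieffer (1957) §II–III. [folklore] -/
theorem pairDensity_le_mul_coupling_mul_log_coupling {c U d₀ : ℝ} (hc : 0 < c) (hU : 0 < U)
    (hd : 0 < d₀) (hL : 3 ≤ L) (hLc : 12800 ≤ c * (L : ℝ) ^ 2) (hLd : 40 ≤ Real.sqrt d₀ * L)
    {n : ℕ} (hC1 : n ≤ (Finset.univ.filter fun k : TorusSite 2 L => torusBand L k ≤ -d₀).card)
    (hC2 : (Finset.univ.filter fun k : TorusSite 2 L => torusBand L k < (-4 : ℝ) + d₀).card < n)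
    {ψ : Fock (Orb (FermionTorus 2 L))}
    (hψ : IsGroundStateInSector (hubbardTorus 2 L 1 U) (2 * n) 0 ψ) (h1 : star ψ ⬝ᵥ ψ = 1)
    (hY : c * (L : ℝ) ^ 4 ≤
      (star ψ ⬝ᵥ (((pairField dWaveFormFactor L)ᴴ * pairField dWaveFormFactor L) *ᵥ ψ)).re) :
    c ≤ 4096 / Real.sqrt d₀ * U * Real.log (4 + 32 / Real.sqrt U) := by
  -- the implicit bound `c ≤ (4096/√d₀)·U·log(4 + 32/√c)` (= `pairDensity_le_mul_coupling_mul_log` of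
  -- `HubbardPairDensityCouplingFloorLog.lean`, re-derived from its two ingredients to keep this file
  -- independent of that module): pairing cost at the BCS rate versus the kinetic budget `U·L²`
  have hn : n ≤ L ^ 2 := by
    refine hC1.trans ?_
    have h := Finset.card_filter_le (Finset.univ : Finset (TorusSite 2 L))
      (fun k => torusBand L k ≤ -d₀)
    rwa [Finset.card_univ, card_torusSite] at h
  have hcost := freeDWavePairing_costs_energy_log_explicit hc hd hL hLc hLd hψ.1 h1 hC1 hC2 hY
  have hfree := re_expect_hubbardTorus_zero_le_of_groundStateInSector hU.le hn hψ h1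
  have hL2 : (0 : ℝ) < (L : ℝ) ^ 2 := by
    have : (0 : ℝ) < (L : ℝ) := by exact_mod_cast Nat.pos_of_ne_zero (NeZero.ne L)
    positivity
  have hsd : 0 < Real.sqrt d₀ := Real.sqrt_pos.2 hd
  have hlog : 0 < Real.log (4 + 32 / Real.sqrt c) := by
    have : 0 < 32 / Real.sqrt c := by
      have := Real.sqrt_pos.2 hc
      positivity
    exact Real.log_pos (by linarith)
  have hmul : Real.sqrt d₀ * c / (4096 * Real.log (4 + 32 / Real.sqrt c)) * (L : ℝ) ^ 2 ≤
      U * (L : ℝ) ^ 2 := by linarith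
  have hfl : Real.sqrt d₀ * c / (4096 * Real.log (4 + 32 / Real.sqrt c)) ≤ U :=
    le_of_mul_le_mul_right hmul hL2
  have h : c ≤ 4096 / Real.sqrt d₀ * U * Real.log (4 + 32 / Real.sqrt c) := by
    rw [div_le_iff₀ (by positivity)] at hfl
    have key : 4096 / Real.sqrt d₀ * U * Real.log (4 + 32 / Real.sqrt c) =
        U * (4096 * Real.log (4 + 32 / Real.sqrt c)) / Real.sqrt d₀ := by ring
    rw [key, le_div_iff₀ hsd]
    linarith
  have hd2 : d₀ ≤ 2 := gapParam_le_two_of_card_hyps hC1 hC2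
  have hA : (1 : ℝ) ≤ 4096 / Real.sqrt d₀ := by
    have hsd : 0 < Real.sqrt d₀ := Real.sqrt_pos.2 hd
    rw [le_div_iff₀ hsd, one_mul]
    have : Real.sqrt d₀ ≤ Real.sqrt 4 := Real.sqrt_le_sqrt (by linarith)
    have h4 : Real.sqrt 4 = 2 := by
      rw [show (4 : ℝ) = 2 ^ 2 by norm_num, Real.sqrt_sq (by norm_num)]
    linarith
  exact le_mul_log_of_le_mul_log_sqrt_self' hc hA hU h

/-- **A-priori form, closed.** For `d₀ > 0`, `U > 0`, `c > 0` with
`(4096/√d₀)·U·log(4 + 32/√U) < c` and the hypotheses above on `(L, n)`, every normalised ground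
state of `hubbardTorus 2 L 1 U` in the sector `(2n, S^z = 0)` has `Re ⟨ψ, Δ_d†Δ_d ψ⟩ < c·L⁴`.
[folklore] -/
theorem re_expect_pairField_dWave_lt_of_groundStateInSector_log_coupling {c U d₀ : ℝ}
    (hc : 0 < c) (hU : 0 < U)
    (hcU : 4096 / Real.sqrt d₀ * U * Real.log (4 + 32 / Real.sqrt U) < c)
    (hd : 0 < d₀) (hL : 3 ≤ L) (hLc : 12800 ≤ c * (L : ℝ) ^ 2) (hLd : 40 ≤ Real.sqrt d₀ * L)
    {n : ℕ} (hC1 : n ≤ (Finset.univ.filter fun k : TorusSite 2 L => torusBand L k ≤ -d₀).card)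
    (hC2 : (Finset.univ.filter fun k : TorusSite 2 L => torusBand L k < (-4 : ℝ) + d₀).card < n)
    {ψ : Fock (Orb (FermionTorus 2 L))}
    (hψ : IsGroundStateInSector (hubbardTorus 2 L 1 U) (2 * n) 0 ψ) (h1 : star ψ ⬝ᵥ ψ = 1) :
    (star ψ ⬝ᵥ (((pairField dWaveFormFactor L)ᴴ * pairField dWaveFormFactor L) *ᵥ ψ)).re <
      c * (L : ℝ) ^ 4 := by
  by_contra h
  push Not at h
  have := pairDensity_le_mul_coupling_mul_log_coupling hc hU hd hL hLc hLd hC1 hC2 hψ h1 h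
  linarith

end Literature.MathematicalPhysics.QuantumLattice
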